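import Summits.HodgeConjecture.HodgeConjecture.Theorems.VHCAbelianSchemesRoadLocallyServedAnchor
import Summits.HodgeConjecture.HodgeConjecture.Theorems.VHCAbelianSchemesRoadSecantQuotientAnchorPinnedDefsPrime
import HarnessLib

/-!
# Road b02 (`VHCAbelianSchemesRoad`, D-0059) — the PINNED secant–quotient instance of the span stub: v3.3's single-carrier stub 2a‴
# (`SecantQuotientAnchorCarrier63PinnedPrime C`) IMPLIES skeleton v3.5.1's span stub 2s′ (`AnchoredSpanAt` at `(𝔄^pin, 𝔖^pin, 𝔖^pin + ℂθ³)`)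

research route conditional on HC_CM; not a corollary; Q11.4-sentence-2 already refuted in dim ≥ 3.
(cell line of seat ab-andre-2: research route, not a corollary; conditional on HC_CM plus one named minimal statement.)

THEOREMS ONLY (no definition, no named fact, no sorry; `HC_CM` occurs nowhere). Seat ab-andre-2 gen 66, the «two-line helper» of LEAD 160
(HOME INBOX «SKELETON v3.5.1 REGISTERED ON 23176»); helper `--supports stmt-HodgeConjecture-23176`; the route, `closes`, the binders and the
registered skeletons are NOT touched. Content: `anchoredSpanAt_of_anchoredCarrierAt` (k = 1) at the pinned anchor data — every class of the served
span `𝔏^pin Y θ := {γ + z•θ³ : γ = 0 ∨ γ ∈ 𝔖^pin Y θ}` is `x•u + z•θ³` with `u ∈ 𝔖^pin Y θ` rational (`x = 1, u = γ`, or `x = 0` and `u` the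
pinned Weil class witnessing the anchor, `secantQuotientAnchorsPinned`); so the STRONGER parent stub 2a‴ of skeleton v3.3 (one `AdmTw′`-carrier for
EVERY rational pinned Weil class) gives the span stub 2s′ with ONE summand — the parent edge 20707-line ⟹ 23176-line at the `(6,3)` cell.
NOT claimed: that either stub holds. References: [Markman2025SecantWeil] Thm. 1.4.1, §1.5; [Bloch1972Semiregularity] Rem. (7.5).
-/

noncomputable section

open CategoryTheory CategoryTheory.Limits AlgebraicGeometry Topology

namespace Summit.HodgeConjecture.HodgeConjecture.Ring2.SemiregularRepresentatives

set_option linter.dupNamespace false -- the cell's namespace repeats the summit name, as in every `Ring2*` file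

open Literature.AlgebraicGeometry Literature.AlgebraicGeometry.Motives Literature.AlgebraicGeometry.HodgeTheory
open Literature.AlgebraicTopology.SingularHomology
open Summit.Ventures.HSemireg (ObjClass)

/-- **The served span of the pinned anchors is spanned, class by class, by ONE rational pinned Weil class and `θ³`**: every
`w = γ + z•θ³` with `γ = 0 ∨ γ ∈ 𝔖^pin Y θ` is `x•u + z•θ³` for some rational `u ∈ 𝔖^pin Y θ` (`u := γ`, `x := 1`; or, for `γ = 0`, `u` the
pinned Weil class witnessing the anchor and `x := 0`). [cite: Markman2025SecantWeil, §1.5 and Thm. 1.4.1] -/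
theorem exists_mem_secantQuotientServedClassesPinned_of_mem_span (Y : SchemeOver ℂ) (θ : complexBetti Y 2)
    (hY : secantQuotientAnchorsPinned Y θ) (w : complexBetti Y (2 * 3))
    (hw : w ∈ {w : complexBetti Y (2 * 3) |
      ∃ γ, (γ = 0 ∨ γ ∈ secantQuotientServedClassesPinned Y θ) ∧ ∃ z : ℂ, w = γ + z • cupPowTwo θ 3}) :
    ∃ u ∈ secantQuotientServedClassesPinned Y θ, IsRationalClass u ∧ ∃ x z : ℂ, w = x • u + z • cupPowTwo θ 3 := by
  obtain ⟨γ, hγ, z, hwz⟩ := hw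
  rcases hγ with h0 | hγS
  · obtain ⟨u, hu⟩ := hY
    exact ⟨u, hu, IsSecantQuotientWeilClassAtPinned.isRationalClass hu, 0, z, by rw [hwz, h0, zero_smul]⟩
  · exact ⟨γ, hγS, IsSecantQuotientWeilClassAtPinned.isRationalClass hγS, 1, z, by rw [hwz, one_smul]⟩

/-- **v3.3's stub 2a‴ ⟹ v3.5.1's stub 2s′**: ONE `AdmTw′`-carrier for every rational pinned Weil class at every pinned anchor
(`SecantQuotientAnchorCarrier63PinnedPrime C` = `AnchoredCarrierAt (tw C AdmTw′) 6 3 𝔄^pin 𝔖^pin`) gives the SPAN datum (one summand) for every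
rational class of `𝔖^pin + ℂθ³` — `anchoredSpanAt_of_anchoredCarrierAt` at the pinned data. The parent edge of the `(6,3)` cell (single ⟹ span).
[cite: Markman2025SecantWeil, Thm. 1.4.1 and §1.5] [cite: Bloch1972Semiregularity, Remark (7.5)] -/
theorem anchoredSpanAt_pinned_of_secantQuotientAnchorCarrier63PinnedPrime (C : ChernCharacterBetti)
    (h : SecantQuotientAnchorCarrier63PinnedPrime C) :
    AnchoredSpanAt (Literature.AlgebraicGeometry.HodgeTheory.twistedReflexiveClass C
        (fun n X₀ I E => Summit.Ventures.HSemireg.gluableSigmaAdmissible n X₀ I E ∨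
          Literature.AlgebraicGeometry.HodgeTheory.bfSingleAdmissible' n X₀ I E)) 6 3
      (fun Y θ ↦ secantQuotientAnchorsPinned Y θ) (fun Y θ ↦ secantQuotientServedClassesPinned Y θ)
      (fun Y θ ↦ {w : complexBetti Y (2 * 3) |
        ∃ γ, (γ = 0 ∨ γ ∈ secantQuotientServedClassesPinned Y θ) ∧ ∃ z : ℂ, w = γ + z • cupPowTwo θ 3}) :=
  anchoredSpanAt_of_anchoredCarrierAt h fun Y θ hY w hw _ ↦ exists_mem_secantQuotientServedClassesPinned_of_mem_span Y θ hY w hw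

/-- **The same for any door**: `AnchoredCarrierAt 𝒪 6 3 𝔄^pin 𝔖^pin ⟹ AnchoredSpanAt 𝒪 6 3 𝔄^pin 𝔖^pin (𝔖^pin + ℂθ³)`.
[cite: Markman2025SecantWeil, Thm. 1.4.1 and §1.5] [cite: Bloch1972Semiregularity, Remark (7.5)] -/
theorem anchoredSpanAt_pinned_of_anchoredCarrierAt_pinned {𝒪 : ObjClass}
    (h : AnchoredCarrierAt 𝒪 6 3 (fun Y θ ↦ secantQuotientAnchorsPinned Y θ) (fun Y θ ↦ secantQuotientServedClassesPinned Y θ)) :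
    AnchoredSpanAt 𝒪 6 3 (fun Y θ ↦ secantQuotientAnchorsPinned Y θ) (fun Y θ ↦ secantQuotientServedClassesPinned Y θ)
      (fun Y θ ↦ {w : complexBetti Y (2 * 3) |
        ∃ γ, (γ = 0 ∨ γ ∈ secantQuotientServedClassesPinned Y θ) ∧ ∃ z : ℂ, w = γ + z • cupPowTwo θ 3}) :=
  anchoredSpanAt_of_anchoredCarrierAt h fun Y θ hY w hw _ ↦ exists_mem_secantQuotientServedClassesPinned_of_mem_span Y θ hY w hw

end Summit.HodgeConjecture.HodgeConjecture.Ring2.SemiregularRepresentatives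

end
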